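import Mathlib
import Summits.Schanuel.Schanuel.Theses.RigidCore
import Summits.Schanuel.Schanuel.Theorems.AclSubsetLogFreeCore.Negative.LogFreeCoreCountable
import Literature.Barriers.Schanuel.AlgebraicIndependenceOfLogarithms
import Literature.NumberTheory.Transcendental.GammaFields
import Literature.NumberTheory.Transcendental.GammaFieldsEcl
import Literature.NumberTheory.Transcendental.GammaStrongDescent
import Literature.NumberTheory.Transcendental.ZilberFieldHomogeneity

/-!
# Line `kernel-tower-relative-lw`: Schanuel on one level of the kernel tower already gives the next relative Lindemann–Weierstrass layer (level filtration of the crux)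

Prover file for the registered stub `stub_relLWStep_of_schanuelOnStageSucc` of line
`kernel-tower-relative-lw` of crux `stmt-Schanuel-0970`
(`Summit.Schanuel.Schanuel.Theses.RigidCore.SchanuelOnLogFreeCore`, "(R)": Schanuel's statement for
`ℚ`-linearly independent tuples from the log-free core `C_EA = ⋃ₘ L_m`, `L_m = stage m` the kernel
tower of `Theorems/AclSubsetLogFreeCore/Negative/LogFreeCoreObjects.lean`: `stage 0 = ℚ(2πi)^{ralg}`,
`stage (m+1) = ℚ(L_m ∪ exp L_m)^{ralg}`).  Write `SC|_L` for Schanuel's statement for `ℚ`-linearly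
independent tuples FROM `L` (always written out, no definition), and `RelLW_{m+1}(m)` for the layer
"exponentials of elements of `L_{m+1}` that are `ℚ`-linearly independent modulo `L_m` are
algebraically independent over `L_{m+1}`".  This file proves

  **`SC|_{L_{m+1}} ⟹ RelLW_{m+1}(m)` for every `m`** (`stub_relLWStep_of_schanuelOnStageSucc`),

the sharpening of the landed calibration `(R) ⟹ RelLW_{m+1}(m)` (`stub_relLWStep_of_crux`, file
`RigidCoreSchanuelOnLogFreeCoreRelLWStepOfCrux.lean`) to the WEAKER hypothesis `SC|_{L_{m+1}}`: that
proof applies (R) only to tuples lying inside `L_{m+1}`, and the hull lemmas it runs on are proved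
level by level, Schanuel being needed at level `k ≤ m + 1` only for tuples from `L_k ≤ L_{m+1}`
(`stage_le_succ`).  Together with the restrictions `KernelTower.schanuelOnStage_mono`
(`SC|_{L_{m'}} ⟹ SC|_{L_m}`, `m ≤ m'`) and `KernelTower.schanuelOnStage_of_crux` (`(R) ⟹ SC|_{L_m}`)
recorded here, and with the landed sector split / tower reduction (`KernelTower.sectorSplit`,
`KernelTower.schanuelOn_stage`, `stub_towerReduction`, file
`RigidCoreSchanuelOnLogFreeCoreTowerReduction.lean`, p110214) this yields the LEVEL FILTRATION of
the crux, `SC|_{L_{m+1}} ⟺ SC|_{L_m} ∧ RelLW_{m+1}(m)` and `(R) ⟺ ∀ m, SC|_{L_m}`; the `↔`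
assembly is left to a later file once the farm has built these modules.

Proof (predimension calculus of Γ-fields, `Literature.NumberTheory.Transcendental.GammaField`:
`δ = predim = td - ldim`, `gens V = V ∪ exp V`, `acl`, `algMatroid ℂ`; M. Bays, J. Kirby,
*Pseudo-exponential maps, variants, and quasiminimality*, Algebra & Number Theory 12 (2018),
arXiv:1512.04262, §9; J. Kirby, *Exponential algebraicity in exponential fields*, Bull. LMS 42
(2010), arXiv:0810.4285, §3).  A HULL of `a` inside `L` is a finitely generated `ℚ`-subspace
`V ≤ L` with `δ(V/0) = 0` and `a ∈ acl (gens V)` (always written out).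
* `SC|_L` gives `δ(X/0) ≥ 0` for finitely generated `X ≤ L` (evaluate at a basis;
  `predim_bot_nonneg`), so `δ = 0` is closed under sums inside `L` (`predim_bot_sup_eq_zero`),
  hulls inside `L` are `exp`-stable (`exists_hull_exp`) and finitely many elements with hulls
  inside `L` have a common hull inside `L` (`exists_common_hull`).
* Level `0` (`SC|_{L_0}`): the kernel line `ℚ·2πi` is a hull of every element of `L_0`.
* LEVEL LEMMA (`exists_hull_of_mem_stage_succ`, from `SC|_{L_m}` only; induction on the level):
  every `a ∈ L_{m+1}` has a hull INSIDE `L_m` (finite character of the algebraic matroid).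
* THE COUNT (`le_trdeg`, under `SC|_{L_{m+1}}`): for `u ⊂ K = L_{m+1}` independent modulo `L_m`,
  a `K`-basis `J` of `e^u`, a finite `c ⊂ K` carrying the dependence and a common hull `V ≤ L_m`
  of `c`: `r = ldim(u/L_m) ≤ ldim(u/V) ≤ td(u/V) ≤ relRank(u ∪ e^u / gens V) ≤ |J| = trdeg_K K(e^u)`;
  `algebraicIndependent_of_le_trdeg_adjoin` finishes.
-/

noncomputable section

open Set IntermediateField
open Literature.NumberTheory.Transcendental Literature.NumberTheory.Transcendental.GammaField
open Summit.Schanuel.Schanuel.Theorems.AclSubsetLogFreeCore.Negative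

namespace Summit.Schanuel.Schanuel.Theorems.RigidCore

namespace RelLWStepOfStageSucc

/-! ## `SC|_L` gives `δ ≥ 0` inside `L`, and `δ = 0` is closed under sums -/

/-- `SC|_L` gives `0 ≤ δ(X/0)` for every finitely generated `ℚ`-subspace `X ≤ L`: evaluate it at a
basis of `X` (`SplitExact.predim_bot_nonneg` with (R) weakened to `SC|_L`).
[cite: BaysKirby2018ANT, Thm 9.1 (proof)] -/
theorem predim_bot_nonneg {L : IntermediateField ℚ ℂ}
    (hS : ∀ (n : ℕ) (x : Fin n → ℂ), (∀ i, x i ∈ L) → LinearIndependent ℚ x →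
      (n : Cardinal) ≤ Algebra.trdeg ℚ ↥(adjoin ℚ (range x ∪ range (Complex.exp ∘ x))))
    {X : Submodule ℚ ℂ} (hXL : X ≤ Subalgebra.toSubmodule L.toSubalgebra)
    (hfg : IsFG (⊥ : Submodule ℚ ℂ) X) : 0 ≤ predim ⊥ X := by
  have hinj : Function.Injective (⊥ : Submodule ℚ ℂ).mkQ :=
    LinearMap.ker_eq_bot.1 (Submodule.ker_mkQ _)
  haveI : Module.Finite ℚ X :=
    Module.Finite.iff_fg.2 (Submodule.fg_of_fg_map_injective _ hinj hfg)
  let b := Module.finBasis ℚ X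
  have hn : ldim (⊥ : Submodule ℚ ℂ) X = Module.finrank ℚ X :=
    (Submodule.equivMapOfInjective _ hinj X).finrank_eq.symm
  have hx : LinearIndependent ℚ (fun i => (b i : ℂ)) :=
    b.linearIndependent.map' X.subtype X.ker_subtype
  have h1 := ZilberHomogeneity.natCast_le_eRk_of_le_trdeg
    (hS (Module.finrank ℚ X) (fun i => (b i : ℂ)) (fun i => hXL (b i).2) hx)
  have h2 : (algMatroid ℂ).eRk
      (range (fun i => (b i : ℂ)) ∪ range (Complex.exp ∘ fun i => (b i : ℂ))) ≤ td ⊥ X := by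
    rw [ZilberHomogeneity.td_bot]
    refine (algMatroid ℂ).eRk_mono ?_
    rintro a (⟨i, rfl⟩ | ⟨i, rfl⟩)
    exacts [mem_gens_of_mem (b i).2, exp_mem_gens (b i).2]
  have h3 := h1.trans h2
  rw [← ENat.coe_toNat (td_ne_top hfg), ENat.coe_le_coe] at h3
  rw [predim_def, hn]
  omega

/-- Sums of `δ = 0` finitely generated subspaces of `L` have `δ = 0` under `SC|_L` (addition
formula, submodularity `δ(W/V) ≤ δ(W/W ∩ V)`, `δ ≥ 0`). [cite: BaysKirby2018ANT, §9] -/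
theorem predim_bot_sup_eq_zero {L : IntermediateField ℚ ℂ}
    (hS : ∀ (n : ℕ) (x : Fin n → ℂ), (∀ i, x i ∈ L) → LinearIndependent ℚ x →
      (n : Cardinal) ≤ Algebra.trdeg ℚ ↥(adjoin ℚ (range x ∪ range (Complex.exp ∘ x))))
    {V W : Submodule ℚ ℂ} (hVL : V ≤ Subalgebra.toSubmodule L.toSubalgebra)
    (hWL : W ≤ Subalgebra.toSubmodule L.toSubalgebra)
    (hVfg : IsFG (⊥ : Submodule ℚ ℂ) V) (hWfg : IsFG (⊥ : Submodule ℚ ℂ) W)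
    (hV0 : predim ⊥ V = 0) (hW0 : predim ⊥ W = 0) : predim ⊥ (V ⊔ W) = 0 := by
  have hge := predim_bot_nonneg hS (sup_le hVL hWL) (hVfg.sup hWfg)
  have hadd := predim_add bot_le (le_sup_left : V ≤ V ⊔ W) (hVfg.sup hWfg)
  rw [predim_sup_left] at hadd
  have hsub : predim V W ≤ predim (W ⊓ V) W := by
    simpa only [predim_sup_right] using predim_sup_le W V (hWfg.of_le_left bot_le)
  have hadd2 := predim_add bot_le (inf_le_left : W ⊓ V ≤ W) hWfg
  have hinf : 0 ≤ predim ⊥ (W ⊓ V) :=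
    predim_bot_nonneg hS (inf_le_left.trans hWL) (hWfg.mono inf_le_left)
  linarith

/-! ## Hulls inside `L` under `SC|_L` -/

/-- Hulls inside `L` are `exp`-stable under `SC|_L`: for `a ∈ L` with a hull `V ≤ L`, the subspace
`V + ℚa ≤ L` is a hull of `eᵃ` (`td(a, eᵃ/V) ≤ 1 = ldim` gives `δ(ℚa/V) ≤ 0`, `SC|_L` gives `≥ 0`).
[cite: BaysKirby2018ANT, §9] -/
theorem exists_hull_exp {L : IntermediateField ℚ ℂ}
    (hS : ∀ (n : ℕ) (x : Fin n → ℂ), (∀ i, x i ∈ L) → LinearIndependent ℚ x →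
      (n : Cardinal) ≤ Algebra.trdeg ℚ ↥(adjoin ℚ (range x ∪ range (Complex.exp ∘ x))))
    {a : ℂ} (haL : a ∈ L)
    (ha : ∃ V : Submodule ℚ ℂ, V ≤ Subalgebra.toSubmodule L.toSubalgebra ∧
      IsFG (⊥ : Submodule ℚ ℂ) V ∧ predim ⊥ V = 0 ∧ a ∈ acl (gens V)) :
    ∃ V : Submodule ℚ ℂ, V ≤ Subalgebra.toSubmodule L.toSubalgebra ∧
      IsFG (⊥ : Submodule ℚ ℂ) V ∧ predim ⊥ V = 0 ∧ Complex.exp a ∈ acl (gens V) := by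
  obtain ⟨V, hV, hVfg, hV0, haV⟩ := ha
  have hV'L : V ⊔ Submodule.span ℚ {a} ≤ Subalgebra.toSubmodule L.toSubalgebra :=
    sup_le hV ((Submodule.span_singleton_le_iff_mem _ _).2 haL)
  have hV'fg : IsFG (⊥ : Submodule ℚ ℂ) (V ⊔ Submodule.span ℚ {a}) :=
    hVfg.sup (isFG_span_of_finite ⊥ (finite_singleton a))
  have htd : td V (Submodule.span ℚ {a}) ≤ 1 := by
    rw [td_span_singleton, (algMatroid ℂ).relRank_insert_eq_of_mem_closure
      ((algMatroid ℂ).closure_subset_closure subset_union_right haV)]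
    exact ((algMatroid ℂ).relRank_le_encard_diff _ _).trans
      ((encard_le_encard sdiff_subset).trans (encard_singleton _).le)
  have hge := predim_bot_nonneg hS hV'L hV'fg
  rw [predim_add bot_le le_sup_left hV'fg, predim_sup_left, hV0, zero_add] at hge
  refine ⟨_, hV'L, hV'fg, ?_, subset_acl _
    (exp_mem_gens (Submodule.mem_sup_right (Submodule.mem_span_singleton_self a)))⟩
  rw [predim_add bot_le le_sup_left hV'fg, predim_sup_left, hV0, zero_add]
  exact le_antisymm (predim_span_singleton_nonpos_of_td_le_one htd) hge

/-- Under `SC|_L`, finitely many elements with hulls inside `L` have a common hull inside `L` (the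
sum of the hulls, `δ = 0` by `predim_bot_sup_eq_zero`). [cite: BaysKirby2018ANT, §9] -/
theorem exists_common_hull {L : IntermediateField ℚ ℂ}
    (hS : ∀ (n : ℕ) (x : Fin n → ℂ), (∀ i, x i ∈ L) → LinearIndependent ℚ x →
      (n : Cardinal) ≤ Algebra.trdeg ℚ ↥(adjoin ℚ (range x ∪ range (Complex.exp ∘ x))))
    {s : Set ℂ} (hs : s.Finite)
    (hsub : ∀ c ∈ s, ∃ V : Submodule ℚ ℂ, V ≤ Subalgebra.toSubmodule L.toSubalgebra ∧
      IsFG (⊥ : Submodule ℚ ℂ) V ∧ predim ⊥ V = 0 ∧ c ∈ acl (gens V)) :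
    ∃ V : Submodule ℚ ℂ, V ≤ Subalgebra.toSubmodule L.toSubalgebra ∧
      IsFG (⊥ : Submodule ℚ ℂ) V ∧ predim ⊥ V = 0 ∧ s ⊆ acl (gens V) := by
  induction s, hs using Set.Finite.induction_on with
  | empty => exact ⟨⊥, bot_le, isFG_self ⊥, predim_self ⊥, empty_subset _⟩
  | insert _ _ ih =>
    obtain ⟨W, hW, hWfg, hW0, hsW⟩ := ih fun c hc => hsub c (mem_insert_of_mem _ hc)
    obtain ⟨V, hV, hVfg, hV0, haV⟩ := hsub _ (mem_insert _ _)
    exact ⟨V ⊔ W, sup_le hV hW, hVfg.sup hWfg,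
      predim_bot_sup_eq_zero hS hV hW hVfg hWfg hV0 hW0,
      insert_subset (acl_mono (gens_mono le_sup_left) haV)
        (hsW.trans (acl_mono (gens_mono le_sup_right)))⟩

/-! ## Hulls inside the levels of the tower -/

/-- Level `0` under `SC|_{L_0}`: the kernel line `ℚ·2πi ≤ stage 0` is a hull of every element of
`stage 0 = ℚ(2πi)^{ralg}` (`td(2πi, e^{2πi}/0) ≤ 1` since `e^{2πi} = 1`, so `δ ≤ 0`; `δ ≥ 0` by
`SC|_{L_0}` at the tuple `(2πi)`). [folklore] -/
theorem exists_hull_of_mem_stage_zero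
    (hS : ∀ (n : ℕ) (x : Fin n → ℂ), (∀ i, x i ∈ stage 0) → LinearIndependent ℚ x →
      (n : Cardinal) ≤ Algebra.trdeg ℚ ↥(adjoin ℚ (range x ∪ range (Complex.exp ∘ x))))
    {a : ℂ} (ha : a ∈ stage 0) :
    ∃ V : Submodule ℚ ℂ, V ≤ Subalgebra.toSubmodule (stage 0).toSubalgebra ∧
      IsFG (⊥ : Submodule ℚ ℂ) V ∧ predim ⊥ V = 0 ∧ a ∈ acl (gens V) := by
  set τ : ℂ := 2 * (Real.pi : ℂ) * Complex.I with hτ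
  have hVL : Submodule.span ℚ {τ} ≤ Subalgebra.toSubmodule (stage 0).toSubalgebra :=
    (Submodule.span_singleton_le_iff_mem _ _).2 two_pi_I_mem_stage_zero
  have hVfg : IsFG (⊥ : Submodule ℚ ℂ) (Submodule.span ℚ {τ}) :=
    isFG_span_of_finite ⊥ (finite_singleton τ)
  have hexp : (Literature.ModelTheory.ExponentialFields.ExponentialRing.exp τ : ℂ) = 1 := by
    show Complex.exp τ = 1
    rw [hτ]
    exact Complex.exp_two_pi_mul_I
  have htd : td ⊥ (Submodule.span ℚ {τ}) ≤ 1 := by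
    rw [td_span_singleton, pair_comm, hexp,
      (algMatroid ℂ).relRank_insert_eq_of_mem_closure (one_mem_acl _)]
    exact ((algMatroid ℂ).relRank_le_encard_diff _ _).trans
      ((encard_le_encard sdiff_subset).trans (encard_singleton _).le)
  refine ⟨Submodule.span ℚ {τ}, hVL, hVfg,
    le_antisymm (predim_span_singleton_nonpos_of_td_le_one htd)
      (predim_bot_nonneg hS hVL hVfg), ?_⟩
  have ha' : IsAlgebraic (adjoin ℚ {τ}) a := mem_relAlg_iff.1 ha
  have ha'' : a ∈ acl ((adjoin ℚ {τ} : IntermediateField ℚ ℂ) : Set ℂ) := by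
    rw [mem_acl_iff, ← coe_toSubalgebra, Algebra.adjoin_eq]
    exact ha'
  rw [acl_adjoin] at ha''
  exact acl_mono (singleton_subset_iff.2
    (mem_gens_of_mem (Submodule.mem_span_singleton_self τ))) ha''

/-- Induction step of the level lemma, under `SC|_{L_m}`: if every element of `stage m` has a hull
inside `stage m`, then so does every element of `stage (m+1)` — it is algebraic over finitely many
`c ∈ stage m` and `e^{c'}`, `c' ∈ stage m` (finite character of the algebraic matroid), whose
hulls inside `stage m` (`exists_hull_exp` for the exponentials) have a common hull.
[cite: Kirby2010, §3] -/
theorem exists_hull_of_mem_stage_succ_aux (m : ℕ)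
    (hS : ∀ (n : ℕ) (x : Fin n → ℂ), (∀ i, x i ∈ stage m) → LinearIndependent ℚ x →
      (n : Cardinal) ≤ Algebra.trdeg ℚ ↥(adjoin ℚ (range x ∪ range (Complex.exp ∘ x))))
    (ih : ∀ c ∈ stage m, ∃ V : Submodule ℚ ℂ, V ≤ Subalgebra.toSubmodule (stage m).toSubalgebra ∧
      IsFG (⊥ : Submodule ℚ ℂ) V ∧ predim ⊥ V = 0 ∧ c ∈ acl (gens V))
    {a : ℂ} (ha : a ∈ stage (m + 1)) :
    ∃ V : Submodule ℚ ℂ, V ≤ Subalgebra.toSubmodule (stage m).toSubalgebra ∧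
      IsFG (⊥ : Submodule ℚ ℂ) V ∧ predim ⊥ V = 0 ∧ a ∈ acl (gens V) := by
  have ha' : IsAlgebraic (adjoin ℚ ((stage m : Set ℂ) ∪ Complex.exp '' (stage m : Set ℂ))) a :=
    mem_relAlg_iff.1 ha
  have ha'' : a ∈ acl ((stage m : Set ℂ) ∪ Complex.exp '' (stage m : Set ℂ)) := by
    rw [← acl_adjoin, mem_acl_iff, ← coe_toSubalgebra, Algebra.adjoin_eq]
    exact ha'
  obtain ⟨I, hIsub, hIfin, -, haI⟩ :=
    (algMatroid ℂ).exists_mem_finite_closure_of_mem_closure ha''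
  obtain ⟨V, hV, hVfg, hV0, hIV⟩ := exists_common_hull hS hIfin fun c hc => by
    rcases hIsub hc with hcm | ⟨c', hc', rfl⟩
    · exact ih c hcm
    · exact exists_hull_exp hS hc' (ih c' hc')
  exact ⟨V, hV, hVfg, hV0, acl_subset_acl_of_subset hIV haI⟩

/-- Under `SC|_{L_m}` every element of `stage m` has a hull inside `stage m` (induction on `m`:
level `0` by the kernel line, level `m+1` by the induction step fed with `SC|_{L_m}`, the
restriction of `SC|_{L_{m+1}}` along `stage m ≤ stage (m+1)`). [cite: Kirby2010, §3] -/
theorem exists_hull_of_mem_stage :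
    ∀ (m : ℕ), (∀ (n : ℕ) (x : Fin n → ℂ), (∀ i, x i ∈ stage m) → LinearIndependent ℚ x →
      (n : Cardinal) ≤ Algebra.trdeg ℚ ↥(adjoin ℚ (range x ∪ range (Complex.exp ∘ x)))) →
      ∀ {a : ℂ}, a ∈ stage m →
        ∃ V : Submodule ℚ ℂ, V ≤ Subalgebra.toSubmodule (stage m).toSubalgebra ∧
          IsFG (⊥ : Submodule ℚ ℂ) V ∧ predim ⊥ V = 0 ∧ a ∈ acl (gens V)
  | 0, hS, _, ha => exists_hull_of_mem_stage_zero hS ha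
  | m + 1, hS, _, ha => by
    have hS' : ∀ (n : ℕ) (x : Fin n → ℂ), (∀ i, x i ∈ stage m) → LinearIndependent ℚ x →
        (n : Cardinal) ≤ Algebra.trdeg ℚ ↥(adjoin ℚ (range x ∪ range (Complex.exp ∘ x))) :=
      fun n x hx hli => hS n x (fun i => stage_le_succ m (hx i)) hli
    obtain ⟨V, hV, hVfg, hV0, haV⟩ :=
      exists_hull_of_mem_stage_succ_aux m hS' (fun c hc => exists_hull_of_mem_stage m hS' hc) ha
    exact ⟨V, hV.trans fun x hx => stage_le_succ m hx, hVfg, hV0, haV⟩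

/-- **Level lemma** (under `SC|_{L_m}` only): every element of `stage (m+1)` has a hull INSIDE
`stage m` — a finitely generated `ℚ`-subspace `V ≤ stage m` with `δ(V/0) = 0` over whose Γ-field
`ℚ(V, e^V)` it is algebraic. [cite: Kirby2010, §3] -/
theorem exists_hull_of_mem_stage_succ (m : ℕ)
    (hS : ∀ (n : ℕ) (x : Fin n → ℂ), (∀ i, x i ∈ stage m) → LinearIndependent ℚ x →
      (n : Cardinal) ≤ Algebra.trdeg ℚ ↥(adjoin ℚ (range x ∪ range (Complex.exp ∘ x))))
    {a : ℂ} (ha : a ∈ stage (m + 1)) :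
    ∃ V : Submodule ℚ ℂ, V ≤ Subalgebra.toSubmodule (stage m).toSubalgebra ∧
      IsFG (⊥ : Submodule ℚ ℂ) V ∧ predim ⊥ V = 0 ∧ a ∈ acl (gens V) :=
  exists_hull_of_mem_stage_succ_aux m hS (fun _ hc => exists_hull_of_mem_stage m hS hc) ha

/-! ## The count -/

/-- **`SC|_{L_{m+1}} ⟹ RelLW_{m+1}(m)`, transcendence-degree form**: for `u ⊂ K = stage (m+1)`
independent modulo `stage m`, `r ≤ trdeg_K K(e^u)`.  Hull count: with `J` a `K`-basis of `e^u` in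
the algebraic matroid, a finite `c ⊂ K` with `u ∪ e^u ⊆ acl (J ∪ c)` (finite character) and a
common hull `V ≤ stage m` of `c` (level lemma, from `SC|_{L_m}`),
`r = ldim(u / stage m) ≤ ldim(u/V) ≤ td(u/V) ≤ relRank(u ∪ e^u / gens V) ≤ |J| = trdeg_K K(e^u)`,
the middle step being `δ(u/V) ≥ 0`, i.e. `SC|_{L_{m+1}}` at `V + ℚu ≤ stage (m+1)`.
[cite: BaysKirby2018ANT, §9] -/
theorem le_trdeg (m : ℕ)
    (hS : ∀ (n : ℕ) (x : Fin n → ℂ), (∀ i, x i ∈ stage (m + 1)) → LinearIndependent ℚ x →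
      (n : Cardinal) ≤ Algebra.trdeg ℚ ↥(adjoin ℚ (range x ∪ range (Complex.exp ∘ x))))
    (r : ℕ) (u : Fin r → ℂ) (hu : ∀ i, u i ∈ stage (m + 1))
    (hli : LinearIndependent ℚ ((Submodule.span ℚ (stage m : Set ℂ)).mkQ ∘ u)) :
    (r : Cardinal) ≤ Algebra.trdeg (stage (m + 1))
      ↥(adjoin (stage (m + 1)) (range fun i => Complex.exp (u i))) := by
  have hS' : ∀ (n : ℕ) (x : Fin n → ℂ), (∀ i, x i ∈ stage m) → LinearIndependent ℚ x →
      (n : Cardinal) ≤ Algebra.trdeg ℚ ↥(adjoin ℚ (range x ∪ range (Complex.exp ∘ x))) :=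
    fun n x hx hli => hS n x (fun i => stage_le_succ m (hx i)) hli
  set K : IntermediateField ℚ ℂ := stage (m + 1) with hK
  set S : Set ℂ := range fun i => Complex.exp (u i) with hSdef
  set T : Set ℂ := range u ∪ range (Complex.exp ∘ u) with hT
  set X : Submodule ℚ ℂ := Submodule.span ℚ (range u) with hX
  have hTfin : T.Finite := (finite_range u).union (finite_range _)
  -- (1) finite character: a basis `J` of `S` over `K` and a finite `I ⊆ J ∪ K` spanning `T`
  obtain ⟨J, hJ⟩ := ((algMatroid ℂ).contract (K : Set ℂ)).exists_isBasis' S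
  have hρ : (algMatroid ℂ).relRank (K : Set ℂ) S = J.encard := by
    rw [Matroid.relRank_eq_eRk_contract, hJ.encard_eq_eRk]
  have hSclJ : S ⊆ (algMatroid ℂ).closure (J ∪ (K : Set ℂ)) := fun a haS => by
    by_cases haM : a ∈ (K : Set ℂ)
    · exact (algMatroid ℂ).subset_closure _ (fun _ _ => mem_univ _) (Or.inr haM)
    · have haE : a ∈ ((algMatroid ℂ).contract (K : Set ℂ)).E := by
        rw [Matroid.contract_ground]; exact ⟨mem_univ a, haM⟩
      have h1 := ((algMatroid ℂ).contract (K : Set ℂ)).inter_ground_subset_closure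
        S ⟨haS, haE⟩
      rw [← hJ.closure_eq_closure, Matroid.contract_closure_eq] at h1
      exact h1.1
  have hTclJ : T ⊆ (algMatroid ℂ).closure (J ∪ (K : Set ℂ)) := by
    rintro a (⟨i, rfl⟩ | ⟨i, rfl⟩)
    · exact (algMatroid ℂ).subset_closure _ (fun _ _ => mem_univ _) (Or.inr (hu i))
    · exact hSclJ ⟨i, rfl⟩
  obtain ⟨I, hIJK, hIfin, -, hTI⟩ :=
    (algMatroid ℂ).exists_subset_finite_closure_of_subset_closure hTfin hTclJ
  -- (2) a common hull `V ≤ stage m` of the finitely many elements of `K` in `I` (level lemma)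
  obtain ⟨V, hV, hVfg, hV0, hcV⟩ := exists_common_hull hS' (hIfin.inter_of_left (K : Set ℂ))
    fun a ha => exists_hull_of_mem_stage_succ m hS' ha.2
  -- (3) over `gens V` the set `T` has relative rank `≤ |J| = relRank (S / K)`
  have hle1 : (algMatroid ℂ).relRank (gens V) T ≤ J.encard := by
    have hTcl : T ⊆ (algMatroid ℂ).closure (J ∪ gens V) := by
      refine hTI.trans ((algMatroid ℂ).closure_subset_closure_of_subset_closure fun a ha => ?_)
      rcases hIJK ha with haJ | haK
      · exact (algMatroid ℂ).subset_closure (J ∪ gens V) (fun _ _ => mem_univ _) (Or.inl haJ)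
      · exact (algMatroid ℂ).closure_subset_closure subset_union_right (hcV ⟨ha, haK⟩)
    calc (algMatroid ℂ).relRank (gens V) T ≤ (algMatroid ℂ).relRank (gens V) J :=
          (algMatroid ℂ).relRank_le_of_subset_closure _ hTcl
      _ ≤ (J \ gens V).encard := (algMatroid ℂ).relRank_le_encard_diff _ _
      _ ≤ J.encard := encard_le_encard sdiff_subset
  -- (4) `td(X/V) ≤ relRank (T / gens V)`; (5) `δ(X/V) ≥ 0`; (6) `ldim(X/V) ≥ ldim(X/stage m) = r`
  have htdle : td V X ≤ (algMatroid ℂ).relRank (gens V) T := by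
    have h := td_span_le_relRank V (range u)
    rw [← range_comp] at h
    exact h
  have hXK : X ≤ Subalgebra.toSubmodule K.toSubalgebra :=
    Submodule.span_le.2 (range_subset_iff.2 fun i => hu i)
  have hXfg : IsFG (⊥ : Submodule ℚ ℂ) X := isFG_span_of_finite ⊥ (finite_range u)
  have hVXfg : IsFG (⊥ : Submodule ℚ ℂ) (V ⊔ X) := hVfg.sup hXfg
  have hpVX := predim_bot_nonneg hS
    (sup_le (hV.trans fun v hv => stage_le_succ m hv) hXK) hVXfg
  rw [predim_add bot_le le_sup_left hVXfg, predim_sup_left, hV0, zero_add, predim_def] at hpVX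
  have hldimM : ldim (Submodule.span ℚ (stage m : Set ℂ)) X = r := by
    rw [ldim, hX, Submodule.map_span, ← range_comp, finrank_span_eq_card hli, Fintype.card_fin]
  have hldim : r ≤ ldim V X := by
    have hVM : V ≤ Submodule.span ℚ (stage m : Set ℂ) :=
      fun v hv => Submodule.subset_span (hV hv)
    have h := ldim_add (inf_le_inf_left X hVM) inf_le_left (hXfg.of_le_left bot_le)
    rw [← ldim_eq_ldim_inf X V, ← ldim_eq_ldim_inf X, hldimM] at h
    omega
  -- (7) `r ≤ ldim(X/V) ≤ td(X/V) ≤ relRank (T / gens V) ≤ |J| = relRank (S / K) = trdeg_K K(S)`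
  refine Cardinal.natCast_le_toENat.1 ?_
  rw [toENat_trdeg_adjoin_eq_relRank K S, hρ]
  calc (r : ℕ∞) ≤ ((td V X).toNat : ℕ∞) := ENat.coe_le_coe.2 (by omega)
    _ = td V X := ENat.coe_toNat (td_ne_top (hXfg.of_le_left bot_le))
    _ ≤ J.encard := htdle.trans hle1

end RelLWStepOfStageSucc

/-- **Registered stub `stub_relLWStep_of_schanuelOnStageSucc` of line `kernel-tower-relative-lw` —
`SC|_{L_{m+1}} ⟹ RelLW_{m+1}(m)` for every `m`** (signature verbatim): under Schanuel's statement
for `ℚ`-linearly independent tuples from `stage (m+1)` alone, exponentials of elements of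
`stage (m+1)` that are `ℚ`-linearly independent modulo `stage m` are algebraically independent
over `stage (m+1)` (`RelLWStepOfStageSucc.le_trdeg`, the hull count through the level lemma, and
`algebraicIndependent_of_le_trdeg_adjoin`).  Sharpens the landed `stub_relLWStep_of_crux`
(`(R) ⟹ RelLW_{m+1}(m)`) and, with the landed sector split, filters the crux by levels:
`SC|_{L_{m+1}} ⟺ SC|_{L_m} ∧ RelLW_{m+1}(m)`. [cite: BaysKirby2018ANT, §9] -/
theorem stub_relLWStep_of_schanuelOnStageSucc :
    ∀ m : ℕ, (∀ (n : ℕ) (x : Fin n → ℂ), (∀ i, x i ∈ stage (m + 1)) → LinearIndependent ℚ x →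
      (n : Cardinal) ≤ Algebra.trdeg ℚ ↥(adjoin ℚ (Set.range x ∪ Set.range (Complex.exp ∘ x)))) →
      ∀ (r : ℕ) (u : Fin r → ℂ), (∀ i, u i ∈ stage (m + 1)) →
        LinearIndependent ℚ ((Submodule.span ℚ (stage m : Set ℂ)).mkQ ∘ u) →
          AlgebraicIndependent (↥(stage (m + 1))) (fun i => Complex.exp (u i)) :=
  fun m hS _ u hu hli =>
    Literature.Barriers.Schanuel.algebraicIndependent_of_le_trdeg_adjoin
      (K := ↥(stage (m + 1))) (fun i => Complex.exp (u i))
      (RelLWStepOfStageSucc.le_trdeg m hS _ u hu hli)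

/-- **`SC|_{L_{m'}} ⟹ SC|_{L_m}` for `m ≤ m'`**: Schanuel's statement for tuples from a level of
the kernel tower restricts to every lower level, along `monotone_stage`. [folklore] -/
theorem KernelTower.schanuelOnStage_mono {m m' : ℕ} (h : m ≤ m') :
    (∀ (n : ℕ) (x : Fin n → ℂ), (∀ i, x i ∈ stage m') → LinearIndependent ℚ x →
      (n : Cardinal) ≤ Algebra.trdeg ℚ ↥(adjoin ℚ (Set.range x ∪ Set.range (Complex.exp ∘ x)))) →
      ∀ (n : ℕ) (x : Fin n → ℂ), (∀ i, x i ∈ stage m) → LinearIndependent ℚ x →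
        (n : Cardinal) ≤ Algebra.trdeg ℚ ↥(adjoin ℚ (Set.range x ∪ Set.range (Complex.exp ∘ x))) :=
  fun hS n x hx hli => hS n x (fun i => monotone_stage h (hx i)) hli

/-- **`(R) ⟹ SC|_{L_m}`**: Schanuel's conjecture for the log-free core restricts to Schanuel's
statement for `ℚ`-linearly independent tuples from every level `L_m = stage m`, along
`stage m ≤ logFreeCore` (`stage_le_of_mem logFreeCore_mem_coreFamily m`; the crux unfolds to
membership in `logFreeCore = sInf coreFamily` definitionally).  With
`stub_relLWStep_of_schanuelOnStageSucc` it re-derives the landed `stub_relLWStep_of_crux`.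
[folklore] -/
theorem KernelTower.schanuelOnStage_of_crux (m : ℕ) :
    Summit.Schanuel.Schanuel.Theses.RigidCore.SchanuelOnLogFreeCore →
      ∀ (n : ℕ) (x : Fin n → ℂ), (∀ i, x i ∈ stage m) → LinearIndependent ℚ x →
        (n : Cardinal) ≤
          Algebra.trdeg ℚ ↥(adjoin ℚ (Set.range x ∪ Set.range (Complex.exp ∘ x))) :=
  fun hR n x hx hli => hR n x (fun i => stage_le_of_mem logFreeCore_mem_coreFamily m (hx i)) hli

end Summit.Schanuel.Schanuel.Theorems.RigidCore

end
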